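import Literature.Topology.FourManifolds.GluckTwist
import Literature.Topology.FourManifolds.GluckTwistProofs
import Literature.Topology.FourManifolds.GluckTwistFacts
import Literature.Topology.FourManifolds.SphereSimplyConnected
import Mathlib.AlgebraicTopology.FundamentalGroupoid.FundamentalGroup
import Mathlib.Topology.Homotopy.Product
import Mathlib.Analysis.Normed.Module.Connected
import Mathlib.Analysis.SpecialFunctions.Trigonometric.Basic
import HarnessLib

/-!
# A Gluck twist is simply connected: reduction to Kervaire's lemma (Gluck 1962 §17)

Sibling file of `GluckTwist.lean` in the decomposition (D-0014 provefact, XL) of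
`Literature.Topology.FourManifolds.nonempty_homeomorph_sphere_of_isGluckTwist` (`Σ_K ≃ₜ S⁴`) recorded in
`GluckTwistHomotopySphere.lean`. It reduces the leaf `Literature.Topology.FourManifolds.simplyConnectedSpace_of_isGluckTwist`
(*a Gluck twist `Σ_K` of `S⁴` along a 2-knot `K` is simply connected*, Gluck, Trans. AMS 104
(1962), §17) to one classical named fact about knot complements, and proves everything else:

* **named fact** `Literature.Topology.FourManifolds.TwoKnot.normalClosure_meridian_eq_top` (Kervaire, *Les nœuds de
  dimensions supérieures*, Bull. Soc. Math. France 93 (1965), Ch. I, Lemme 1.2 and its proof,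
  pp. 228–229): the fundamental group of the complement `S⁴ ∖ K(S²)` of a 2-knot, based at a
  point `x₀` of the boundary circle `∂Q` of a fibre disc `Q` of a tubular neighbourhood of `K`, is
  the normal closure of the class of `∂Q` (a *meridian* of `K`); i.e. `π₁(S⁴ ∖ K)` has weight one,
  normally generated by a meridian.
* **proved** `Literature.Topology.FourManifolds.simplyConnectedSpace_of_isGluckTwist_of`: the leaf, from the named fact. The
  printed argument (Gluck 1962, §17; Gompf–Stipsicz, *4-Manifolds and Kirby Calculus*, Ex.
  6.2.2): `Σ_K = (S⁴ ∖ K) ∪ (S² × D²)` with both pieces open (in the open relational model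
  `Literature.Topology.FourManifolds.IsGluckTwist`: the ranges of the gluing embeddings `jA : S⁴ ∖ K(S²) → X`,
  `jB : S² × ℝ² → X`) and path-connected intersection `≅ S² × (ℝ² ∖ 0)`; loops in `jB(S² × ℝ²)`
  are null-homotopic because `S² × ℝ²` is simply connected; a loop in `jA(S⁴ ∖ K)` is `jA ∘ δ` for
  a loop `δ` of the knot complement, whose class lies in the normal closure of the meridian
  (Kervaire), and `jA ∘ (meridian) ⊆ jB(S² × (ℝ² ∖ 0))` is null-homotopic in `X`, so
  `(jA)_* : π₁(S⁴ ∖ K) → π₁(X)` is trivial; Hatcher's Lemma 1.15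
  (`Literature.Topology.FourManifolds.Path.Homotopic.refl_of_isOpen_cover_two`, `SphereSimplyConnected.lean`) then kills every
  loop of `X`.

## Other results (all proved)

* `Literature.Topology.FourManifolds.simplyConnectedSpace_of_isOpen_cover_of_loops`: van Kampen, easy half, in the flexible form
  "`X = U ∪ V` open cover, `U ∩ V` path connected, loops of `U` and of `V` die in `X` `⇒`
  `π₁(X) = 1`" (Hatcher, *Algebraic Topology*, Lemma 1.15).
* `Literature.Topology.FourManifolds.IsPreconnected.of_isOpen_cover`: if `X = U ∪ V` is preconnected with `U`, `V` open and
  `U ∩ V` preconnected then `U` is preconnected (elementary).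
* `Literature.Topology.FourManifolds.simplyConnectedSpace_prod`: a product of simply connected spaces is simply connected.
* `Literature.Topology.FourManifolds.TwoKnot.TubularNbhd.isPathConnected_compl_range`: the complement `S⁴ ∖ K(S²)` of a 2-knot
  with a tubular neighbourhood is path connected (`S⁴ = (S⁴ ∖ K) ∪ ν(S² × ℝ²)` with intersection
  `ν(S² × (ℝ² ∖ 0))` connected; uses invariance of domain `TwoKnot.TubularNbhd.isOpen_range` from
  `GluckTwistProofs.lean`).
* `Literature.Topology.FourManifolds.TwoKnot.TubularNbhd.meridian`: the meridian loop `t ↦ ν (y, r • (cos 2πt, sin 2πt))` of a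
  2-knot in its complement, based at `ν (y, (r, 0))`.
* `Literature.Topology.FourManifolds.simplyConnectedSpace_of_isGluckTwist_of_euclidean`: the `𝓡 4`-modelled,
  universe-polymorphic shape of the leaf consumed (as `hπ`) by
  `GluckTwistHomotopySphere.nonempty_homotopyEquiv_sphere_of_isGluckTwist_of`;
  `Literature.Topology.FourManifolds.gluck_simplyConnected_of`: the route fact `gluck_simplyConnected` (`GluckTwistFacts.lean`)
  from Kervaire's lemma.

## References

* H. Gluck, *The embedding of two-spheres in the four-sphere*, Trans. Amer. Math. Soc. 104 (1962)
  308–333, §17 [GluckTAMS1962].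
* M. A. Kervaire, *Les nœuds de dimensions supérieures*, Bull. Soc. Math. France 93 (1965)
  225–271, Ch. I §1, Lemme 1.2, pp. 228–229 [KervaireBSMF1965].
* A. Hatcher, *Algebraic Topology* (2002), §1.1 Lemma 1.15, §1.2 (van Kampen) [HatcherAT2002].
* R. Gompf, A. Stipsicz, *4-Manifolds and Kirby Calculus* (1999), §6.2, Ex. 6.2.2.

## Design notes

* Kervaire's Lemme 1.2 is stated for a connected submanifold `V` of a simply connected smooth
  manifold `M` (weight of `π₁(M ∖ V)` at most one, the normally generating element exhibited in
  the proof being the boundary of a fibre disc of a tubular neighbourhood). It is vendored in the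
  specialisation used here: `M = S⁴`, `V = K(S²)` for a smooth 2-knot `K`, the tubular
  neighbourhood being any `Literature.TwoKnot.TubularNbhd K` (a smooth embedding `ν : S² × ℝ² → S⁴` with
  `ν (x, 0) = K x`; its range is open by `TwoKnot.TubularNbhd.isOpen_range`, so `ν` is a tubular
  neighbourhood in the classical sense), the fibre disc `Q = ν({y} × D_r)` and the base point
  `x₀ = ν (y, (r, 0)) ∈ ∂Q`. The fundamental group is Mathlib's `FundamentalGroup`, the class of
  the meridian is `FundamentalGroup.fromPath (Path.Homotopic.Quotient.mk _)` and "adhérence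
  normale" is `Subgroup.normalClosure`.
* `simplyConnectedSpace_of_isGluckTwist` quantifies over an arbitrary model `IX` of `X`; the proof
  only uses that the gluing maps are topological embeddings with open ranges, so the reduction is
  equally general.
* No declaration in this file uses `sorry`.
-/

noncomputable section

open Set Function unitInterval
open scoped Topology Manifold ContDiff Real

namespace Literature.Topology.FourManifolds

/-! ### Van Kampen, easy half, flexible form -/

section General

variable {X : Type*} [TopologicalSpace X]

/-- **Van Kampen, easy half** (Hatcher, *Algebraic Topology*, Lemma 1.15), flexible form: if
`X = U ∪ V` with `U`, `V` open and path connected, `x₀ ∈ U ∩ V`, `U ∩ V` path connected, and every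
loop at `x₀` lying in `U` or in `V` is null-homotopic **in `X`**, then `X` is simply connected.
(`Literature.Topology.FourManifolds.simplyConnectedSpace_of_isOpen_union` is the case where `U`, `V` are themselves simply
connected.) [cite: HatcherAT2002, Lemma 1.15] -/
theorem simplyConnectedSpace_of_isOpen_cover_of_loops {U V : Set X} (hU : IsOpen U)
    (hV : IsOpen V) (hUV : U ∪ V = univ) {x₀ : X} (hxU : x₀ ∈ U) (hxV : x₀ ∈ V)
    (hUpc : IsPathConnected U) (hVpc : IsPathConnected V)
    (hloopU : ∀ δ : Path x₀ x₀, (∀ s, δ s ∈ U) → δ.Homotopic (Path.refl x₀))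
    (hloopV : ∀ δ : Path x₀ x₀, (∀ s, δ s ∈ V) → δ.Homotopic (Path.refl x₀))
    (hmeet : IsPathConnected (U ∩ V)) : SimplyConnectedSpace X := by
  have hpc : IsPathConnected (univ : Set X) := by
    rw [← hUV]
    exact hUpc.union hVpc ⟨x₀, hxU, hxV⟩
  haveI : PathConnectedSpace X := pathConnectedSpace_iff_univ.mpr hpc
  rw [simply_connected_iff_loops_nullhomotopic]
  refine ⟨inferInstance, fun x γ => ?_⟩
  have α : Path x₀ x := (hpc.joinedIn x₀ (mem_univ _) x (mem_univ _)).somePath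
  exact Path.Homotopic.refl_of_conj α
    (Path.Homotopic.refl_of_isOpen_cover_two hU hV hUV hxU hxV hloopU hloopV hmeet _)

/-- If a preconnected space is the union of two open sets `U`, `V` with preconnected intersection,
then `U` is preconnected (a separation of `U` would restrict to one side on `U ∩ V` and then extend
by `V` to a separation of the whole space). Elementary point-set topology. [folklore] -/
theorem IsPreconnected.of_isOpen_cover [PreconnectedSpace X] {U V : Set X} (hU : IsOpen U)
    (hV : IsOpen V) (hUV : U ∪ V = univ) (hI : IsPreconnected (U ∩ V)) :
    IsPreconnected U := by
  rw [isPreconnected_iff_subset_of_disjoint] at hI ⊢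
  intro u v hu hv hsub hdisj
  have hIsub : U ∩ V ⊆ u ∪ v := inter_subset_left.trans hsub
  have hIdisj : U ∩ V ∩ (u ∩ v) = ∅ := by
    apply eq_empty_of_subset_empty
    rw [← hdisj]
    exact inter_subset_inter_left _ inter_subset_left
  have huniv := (isPreconnected_iff_subset_of_disjoint.1 (isPreconnected_univ (α := X)))
  -- symmetric treatment of the two sides
  suffices key : ∀ u v : Set X, IsOpen u → IsOpen v → U ⊆ u ∪ v → U ∩ (u ∩ v) = ∅ →
      U ∩ V ⊆ u → U ⊆ u ∨ U ⊆ v by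
    rcases hI u v hu hv hIsub hIdisj with h | h
    · exact key u v hu hv hsub hdisj h
    · rw [union_comm] at hsub
      rw [inter_comm u v] at hdisj
      exact (key v u hv hu hsub hdisj h).symm
  intro u v hu hv hsub hdisj h
  have h1 : IsOpen (u ∩ U ∪ V) := (hu.inter hU).union hV
  have h2 : IsOpen (v ∩ U) := hv.inter hU
  have hcov : (univ : Set X) ⊆ (u ∩ U ∪ V) ∪ (v ∩ U) := by
    intro x _
    have hx : x ∈ U ∪ V := by rw [hUV]; exact mem_univ x
    rcases hx with hxU | hxV
    · rcases hsub hxU with hxu | hxv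
      · exact Or.inl (Or.inl ⟨hxu, hxU⟩)
      · exact Or.inr ⟨hxv, hxU⟩
    · exact Or.inl (Or.inr hxV)
  have hdisj' : (univ : Set X) ∩ ((u ∩ U ∪ V) ∩ (v ∩ U)) = ∅ := by
    rw [univ_inter]
    apply eq_empty_of_forall_notMem
    rintro x ⟨hx1 | hx1, hxv, hxU⟩
    · have : x ∈ U ∩ (u ∩ v) := ⟨hxU, hx1.1, hxv⟩
      rw [hdisj] at this
      exact this
    · have : x ∈ U ∩ (u ∩ v) := ⟨hxU, h ⟨hxU, hx1⟩, hxv⟩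
      rw [hdisj] at this
      exact this
  rcases huniv _ _ h1 h2 hcov hdisj' with H | H
  · left
    intro x hxU
    rcases H (mem_univ x) with hx | hxV
    · exact hx.1
    · exact h ⟨hxU, hxV⟩
  · right
    exact fun x hxU => (H (mem_univ x)).1

/-- **A product of simply connected spaces is simply connected**: path classes in `Y × Z` are
determined by their two projections (`Path.Homotopic.prod_projLeft_projRight`), which are unique.
Standard (Hatcher, *Algebraic Topology*, Prop. 1.12: `π₁(X × Y) ≅ π₁(X) × π₁(Y)`). [folklore] -/
theorem simplyConnectedSpace_prod {Y Z : Type*} [TopologicalSpace Y] [TopologicalSpace Z]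
    [SimplyConnectedSpace Y] [SimplyConnectedSpace Z] : SimplyConnectedSpace (Y × Z) := by
  rw [simply_connected_iff_paths_homotopic]
  refine ⟨inferInstance, ?_⟩
  rintro ⟨a₁, b₁⟩ ⟨a₂, b₂⟩
  refine ⟨fun p q => ?_⟩
  rw [← Path.Homotopic.prod_projLeft_projRight p, ← Path.Homotopic.prod_projLeft_projRight q,
    Subsingleton.elim (Path.Homotopic.projLeft p) (Path.Homotopic.projLeft q),
    Subsingleton.elim (Path.Homotopic.projRight p) (Path.Homotopic.projRight q)]

end General

/-- Local notation: `𝔼 n` is the model Euclidean space `EuclideanSpace ℝ (Fin n)`. -/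
local notation "𝔼 " n:arg => EuclideanSpace ℝ (Fin n)

/-- Local notation: `𝕊 n` is the unit sphere in `EuclideanSpace ℝ (Fin (n + 1))`. -/
local notation "𝕊 " n:arg => (Metric.sphere (0 : EuclideanSpace ℝ (Fin (n + 1))) 1)

/-! ### Circles in the plane -/

/-- Circle points `r • (cos θ, sin θ)` of non-zero radius are non-zero (`circlePoint` from
`Knots.lean`, as for the 1-knot meridian `Knot.TubularNbhd.meridian`). [folklore] -/
theorem smul_circlePoint_ne_zero {r : ℝ} (hr : r ≠ 0) (θ : ℝ) :
    r • ((circlePoint θ : 𝕊 1) : 𝔼 2) ≠ 0 :=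
  smul_ne_zero hr (ne_zero_of_mem_unit_sphere _)

/-- After a full turn the circle point returns to its start. [folklore] -/
theorem circlePoint_two_pi_mul_one : circlePoint (2 * π * (1 : ℝ)) = circlePoint 0 := by
  rw [mul_one, ← zero_add (2 * π), circlePoint_add_two_pi]

/-! ### Meridians of 2-knots and Kervaire's lemma -/

namespace TwoKnot.TubularNbhd

variable {K : TwoKnot} (ν : TwoKnot.TubularNbhd K)

/-- The point `ν (y, r • (cos θ, sin θ))`, `r ≠ 0`, of the tubular neighbourhood, as a point of
the knot complement `S⁴ ∖ K(S²)` (it lies off the zero section, `apply_mem_compl_range`); the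
circle is parametrised by `circlePoint` (`Knots.lean`), as for the 1-knot meridian
`Knot.TubularNbhd.meridian` (`DehnSurgery.lean`). [folklore] -/
def fibrePt (y : 𝕊 2) {r : ℝ} (hr : r ≠ 0) (θ : ℝ) : K.complement :=
  ⟨ν.toFun (y, r • ((circlePoint θ : 𝕊 1) : 𝔼 2)),
    ν.apply_mem_compl_range y (smul_circlePoint_ne_zero hr θ)⟩

/-- Underlying point of `fibrePt`. [folklore] -/
@[simp]
theorem coe_fibrePt (y : 𝕊 2) {r : ℝ} (hr : r ≠ 0) (θ : ℝ) :
    (ν.fibrePt y hr θ : 𝕊 4) = ν.toFun (y, r • ((circlePoint θ : 𝕊 1) : 𝔼 2)) := rfl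

/-- `θ ↦ fibrePt y r θ` is continuous. [folklore] -/
theorem continuous_fibrePt (y : 𝕊 2) {r : ℝ} (hr : r ≠ 0) :
    Continuous (fun θ : ℝ => ν.fibrePt y hr θ) :=
  Continuous.subtype_mk (ν.continuous.comp (continuous_const.prodMk
    ((continuous_const (y := r)).smul (continuous_subtype_val.comp continuous_circlePoint)))) _

/-- **The meridian of a 2-knot.** For a tubular neighbourhood `ν : S² × ℝ² → S⁴` of the 2-knot
`K`, a point `y ∈ S²` and a radius `r > 0`, the loop `t ↦ ν (y, r • (cos 2πt, sin 2πt))` in the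
knot complement `S⁴ ∖ K(S²)`, based at `ν (y, (r, 0))`: the boundary circle `∂Q` of the fibre disc
`Q = ν ({y} × D_r)` through `K y` (Kervaire, Bull. SMF 93 (1965), p. 229; Rolfsen, *Knots and
Links*, §3). [folklore] -/
def meridian (y : 𝕊 2) {r : ℝ} (hr : 0 < r) :
    Path (ν.fibrePt y hr.ne' 0) (ν.fibrePt y hr.ne' 0) where
  toFun t := ν.fibrePt y hr.ne' (2 * π * t)
  continuous_toFun :=
    (ν.continuous_fibrePt y hr.ne').comp (continuous_const.mul continuous_subtype_val)
  source' := by simp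
  target' := by
    apply Subtype.ext
    simp only [Set.Icc.coe_one, coe_fibrePt, circlePoint_two_pi_mul_one]

/-- Values of the meridian loop. [folklore] -/
theorem meridian_apply (y : 𝕊 2) {r : ℝ} (hr : 0 < r) (t : I) :
    ν.meridian y hr t = ν.fibrePt y hr.ne' (2 * π * t) := rfl

end TwoKnot.TubularNbhd

/-- **Kervaire's lemma: the group of a 2-knot is normally generated by a meridian** (Kervaire,
*Les nœuds de dimensions supérieures*, Bull. Soc. Math. France 93 (1965), Ch. I, Lemme 1.2, with
its proof, pp. 228–229: for a connected submanifold `V` of a simply connected smooth manifold `M`,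
`T` a tubular neighbourhood of `V`, `Q` the fibre disc of `T` through a point `a₀ ∈ V` and `x₀` a
point of `∂Q`, "le bord de `Q` détermine un élément `α` de `π₁(M − V, x₀)` … l'adhérence normale
de `α` est `π₁(M − V, x₀)`"; in particular the weight of `π₁(M − V)` is at most one). Vendored in
the case `M = S⁴`, `V = K(S²)` for a smooth 2-knot `K` with tubular neighbourhood
`ν : S² × ℝ² → S⁴`, `Q = ν({y} × D_r)`, `x₀ = ν (y, (r, 0))`, `α` the class of the meridian
`TwoKnot.TubularNbhd.meridian ν y r`: the normal closure of `α` in `π₁(S⁴ ∖ K(S²), x₀)` is the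
whole group. [cite: KervaireBSMF1965, Ch. I, Lemme 1.2 (proof), pp. 228–229] -/
def TwoKnot.normalClosure_meridian_eq_top : Prop :=
  ∀ (K : TwoKnot) (ν : TwoKnot.TubularNbhd K) (y : 𝕊 2) (r : ℝ) (hr : 0 < r),
    Subgroup.normalClosure
        {(FundamentalGroup.fromPath (Path.Homotopic.Quotient.mk (ν.meridian y hr)) :
          FundamentalGroup K.complement (ν.fibrePt y hr.ne' 0))} = ⊤

/-! ### The complement of a 2-knot is path connected -/

namespace TwoKnot.TubularNbhd

variable {K : TwoKnot}

/-- The part of a tubular neighbourhood lying in the knot complement is the image of the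
complement `S² × (ℝ² ∖ 0)` of the zero section. [folklore] -/
theorem compl_range_inter_range (ν : TwoKnot.TubularNbhd K) :
    (range K)ᶜ ∩ range ν.toFun = ν.toFun '' {p | p.2 ≠ 0} := by
  ext a
  constructor
  · rintro ⟨ha, ⟨y, w⟩, rfl⟩
    refine ⟨(y, w), ?_, rfl⟩
    rintro (rfl : w = 0)
    exact ha ⟨y, (ν.apply_zero y).symm⟩
  · rintro ⟨⟨y, w⟩, hw, rfl⟩
    exact ⟨ν.apply_mem_compl_range y hw, mem_range_self _⟩

/-- `S² × (ℝ² ∖ 0)` is path connected (`S²` and the punctured plane are). [folklore] -/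
theorem isPathConnected_compl_zeroSection :
    IsPathConnected {p : (𝕊 2) × 𝔼 2 | p.2 ≠ 0} := by
  have h1 : IsPathConnected (univ : Set (𝕊 2)) := by
    have h : IsPathConnected (Metric.sphere (0 : 𝔼 3) 1) := by
      apply isPathConnected_sphere
      · rw [← Module.finrank_eq_rank, finrank_euclideanSpace_fin]
        norm_num
      · norm_num
    haveI := isPathConnected_iff_pathConnectedSpace.mp h
    exact isPathConnected_univ
  have h2 : IsPathConnected ({0}ᶜ : Set (𝔼 2)) := by
    apply isPathConnected_compl_singleton_of_one_lt_rank
    rw [← Module.finrank_eq_rank, finrank_euclideanSpace_fin]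
    norm_num
  have h := h1.prod h2
  convert h using 1
  ext p
  simp

/-- **The complement of a 2-knot is path connected.** For a 2-knot `K : S² ↪ S⁴` with a tubular
neighbourhood `ν`, `S⁴ ∖ K(S²)` is path connected: `S⁴ = (S⁴ ∖ K) ∪ ν(S² × ℝ²)` is a cover by two
open sets (invariance of domain, `TwoKnot.TubularNbhd.isOpen_range`) with connected intersection
`ν(S² × (ℝ² ∖ 0))`, so `S⁴ ∖ K` is connected, and it is locally path connected (codimension-two
complements are connected; e.g. Rolfsen, *Knots and Links*, §3, or Alexander duality).
[folklore] -/
theorem isPathConnected_compl_range (ν : TwoKnot.TubularNbhd K) :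
    IsPathConnected ((range K)ᶜ : Set (𝕊 4)) := by
  haveI : PreconnectedSpace (𝕊 4) := by
    have h : IsPreconnected (Metric.sphere (0 : 𝔼 5) 1) := by
      apply isPreconnected_sphere
      rw [← Module.finrank_eq_rank, finrank_euclideanSpace_fin]
      norm_num
    exact isPreconnected_iff_preconnectedSpace.mp h
  haveI : LocallyPathConnectedSpace (𝕊 4) := ChartedSpace.locallyPathConnectedSpace (𝔼 4) (𝕊 4)
  have hUo : IsOpen ((range K)ᶜ : Set (𝕊 4)) := K.isClosed_range.isOpen_compl
  have hcov : (range K)ᶜ ∪ range ν.toFun = univ := by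
    refine eq_univ_of_forall fun a => ?_
    by_cases ha : a ∈ range K
    · exact Or.inr (ν.range_subset_range ha)
    · exact Or.inl ha
  have hpre : IsPreconnected ((range K)ᶜ : Set (𝕊 4)) := by
    refine IsPreconnected.of_isOpen_cover hUo ν.isOpen_range hcov ?_
    rw [ν.compl_range_inter_range]
    exact (TubularNbhd.isPathConnected_compl_zeroSection.image
      ν.continuous).isConnected.isPreconnected
  have hne : ((range K)ᶜ : Set (𝕊 4)).Nonempty :=
    ⟨_, ν.apply_mem_compl_range (⟨EuclideanSpace.single 0 1, by simp⟩ : 𝕊 2)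
      (smul_circlePoint_ne_zero one_ne_zero 0)⟩
  exact hUo.isConnected_iff_isPathConnected.mp ⟨hne, hpre⟩

/-- The knot complement, as a space, is path connected. [folklore] -/
theorem pathConnectedSpace_complement (ν : TwoKnot.TubularNbhd K) :
    PathConnectedSpace K.complement :=
  isPathConnected_iff_pathConnectedSpace.mp ν.isPathConnected_compl_range

end TwoKnot.TubularNbhd

/-! ### Simple connectivity of Gluck twists -/

section GluckTwist

/-- `S² × ℝ²` is simply connected (`π₁(S²) = 1`, Hatcher Prop. 1.14, and `ℝ²` is contractible).
[folklore] -/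
theorem simplyConnectedSpace_sphereTwo_prod_plane : SimplyConnectedSpace ((𝕊 2) × 𝔼 2) := by
  haveI : SimplyConnectedSpace (𝕊 2) := simplyConnectedSpace_euclideanSphere (n := 2) le_rfl
  exact simplyConnectedSpace_prod

variable {EX HX : Type*} [NormedAddCommGroup EX] [NormedSpace ℝ EX] [TopologicalSpace HX]
  {IX : ModelWithCorners ℝ EX HX} {X : Type*} [TopologicalSpace X] [ChartedSpace HX X]
  {K : TwoKnot}

/-- **A Gluck twist is simply connected** (Gluck, Trans. AMS 104 (1962), §17; Gompf–Stipsicz,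
Ex. 6.2.2), granted Kervaire's lemma that the knot group is normally generated by a meridian
(`TwoKnot.normalClosure_meridian_eq_top`). Proof: `X` is covered by the open sets
`U = jA(S⁴ ∖ K)` and `V = jB(S² × ℝ²)` with `U ∩ V = jB(S² × (ℝ² ∖ 0))` path connected; loops in
`V` are null-homotopic in `X` since `S² × ℝ²` is simply connected; a loop in `U` based at
`x₀ = jA (ν (y, (1, 0)))` lifts to a loop `δ` of `S⁴ ∖ K`, and
`(jA)_* : π₁(S⁴ ∖ K, ν (y, (1, 0))) → π₁(X, x₀)` is trivial because its kernel is a normal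
subgroup containing the meridian (`jA ∘ meridian` runs in `V`); conclude by Hatcher's Lemma 1.15
(`simplyConnectedSpace_of_isOpen_cover_of_loops`). Discharges the leaf
`simplyConnectedSpace_of_isGluckTwist` of the decomposition of
`nonempty_homeomorph_sphere_of_isGluckTwist` modulo Kervaire's lemma.
[cite: GluckTAMS1962, §17] -/
theorem simplyConnectedSpace_of_isGluckTwist_of (hK : TwoKnot.normalClosure_meridian_eq_top) :
    simplyConnectedSpace_of_isGluckTwist (IX := IX) (X := X) (K := K) := by
  intro h
  obtain ⟨ν, jA, jB, hA, hAo, hB, hBo, hU, hR⟩ := h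
  have hjA : Continuous jA := hA.isEmbedding.continuous
  have hjB : Continuous jB := hB.isEmbedding.continuous
  -- points `jA (ν (y, w))`, `w ≠ 0`, lie in the range of `jB`
  have hAV : ∀ (y : 𝕊 2) (w : 𝔼 2) (hw : w ≠ 0),
      jA ⟨ν.toFun (y, w), ν.apply_mem_compl_range y hw⟩ ∈ range jB := by
    intro y w hw
    obtain ⟨⟨x', w'⟩, -, hxy⟩ :=
      bijOn_gluckMap.surjOn (show ((y, w) : (𝕊 2) × 𝔼 2) ∈ {p | p.2 ≠ 0} from hw)
    have hww : w' = w := by simpa using congrArg Prod.snd hxy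
    subst hww
    refine ⟨(x', w'), ?_⟩
    rw [eq_comm, hR]
    exact ⟨hw, by rw [hxy]⟩
  -- base points
  let y₁ : 𝕊 2 := ⟨EuclideanSpace.single 0 1, by simp⟩
  let a₀ : K.complement := ν.fibrePt y₁ one_ne_zero 0
  let x₀ : X := jA a₀
  have hx₀U : x₀ ∈ range jA := ⟨a₀, rfl⟩
  have hx₀V : x₀ ∈ range jB := hAV y₁ _ (smul_circlePoint_ne_zero one_ne_zero 0)
  -- the intersection of the two open pieces
  have hUV : range jA ∩ range jB = jB '' {p | p.2 ≠ 0} := by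
    ext p
    constructor
    · rintro ⟨⟨a, rfl⟩, ⟨b, hb⟩⟩
      exact ⟨b, ((hR a b).1 hb.symm).1, hb⟩
    · rintro ⟨⟨x, w⟩, hw, rfl⟩
      refine ⟨?_, ⟨(x, w), rfl⟩⟩
      have hm : ν.toFun (gluckMap (x, w)) ∈ K.complement := by
        rw [gluckMap_apply_of_ne_zero x hw]
        exact ν.apply_mem_compl_range _ hw
      exact ⟨⟨_, hm⟩, (hR _ _).2 (gluckRel_mk_gluckMap ν x hw hm)⟩
  have hmeet : IsPathConnected (range jA ∩ range jB) := by
    rw [hUV]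
    exact TwoKnot.TubularNbhd.isPathConnected_compl_zeroSection.image hjB
  -- the piece `V = jB (S² × ℝ²)` is simply connected
  haveI : SimplyConnectedSpace ((𝕊 2) × 𝔼 2) := simplyConnectedSpace_sphereTwo_prod_plane
  have hVsc : IsSimplyConnected (range jB) := by
    rw [← image_univ, hB.isEmbedding.isSimplyConnected_image]
    exact (Homeomorph.Set.univ ((𝕊 2) × 𝔼 2)).symm.toHomotopyEquiv.symm.simplyConnectedSpace
  have hloopV : ∀ δ : Path x₀ x₀, (∀ s, δ s ∈ range jB) → δ.Homotopic (Path.refl x₀) := by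
    intro δ hδ
    obtain ⟨F, -⟩ := (isSimplyConnected_iff_exists_homotopy_refl_forall_mem.mp hVsc).2 x₀ δ hδ
    exact ⟨F⟩
  -- the meridian dies in `X`: it runs in `V`
  have hmer : ((ν.meridian y₁ one_pos).map hjA).Homotopic (Path.refl x₀) :=
    hloopV _ fun s => hAV y₁ _ (smul_circlePoint_ne_zero one_ne_zero _)
  -- hence `(jA)_*` is trivial on `π₁(S⁴ ∖ K, a₀)` (Kervaire)
  let φ : FundamentalGroup K.complement a₀ →* FundamentalGroup X x₀ :=
    FundamentalGroup.map ⟨jA, hjA⟩ a₀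
  have hφ : ∀ (δ : Path a₀ a₀),
      φ (FundamentalGroup.fromPath (Path.Homotopic.Quotient.mk δ)) =
        FundamentalGroup.fromPath (Path.Homotopic.Quotient.mk (δ.map hjA)) := by
    intro δ
    rfl
  have hker : φ.ker = ⊤ := by
    refine top_le_iff.mp ?_
    rw [← hK K ν y₁ 1 one_pos]
    refine Subgroup.normalClosure_le_normal ?_
    rintro _ rfl
    rw [SetLike.mem_coe, MonoidHom.mem_ker, hφ, FundamentalGroup.one_def,
      ← Path.Homotopic.Quotient.mk_refl]
    exact Path.Homotopic.Quotient.eq.mpr hmer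
  -- loops in `U = jA (S⁴ ∖ K)` die in `X`
  have hloopU : ∀ δ : Path x₀ x₀, (∀ s, δ s ∈ range jA) → δ.Homotopic (Path.refl x₀) := by
    intro δ hδ
    -- lift `δ` to the knot complement through the embedding `jA`
    let eA := hA.isEmbedding.toHomeomorph
    have hlift : ∀ (s : I), jA (eA.symm ⟨δ s, hδ s⟩) = δ s := by
      intro s
      have h := congrArg Subtype.val (eA.apply_symm_apply ⟨δ s, hδ s⟩)
      rwa [Topology.IsEmbedding.toHomeomorph_apply_coe] at h
    have hends : eA.symm ⟨x₀, hx₀U⟩ = a₀ := hA.isEmbedding.toHomeomorph_symm_apply a₀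
    let δ' : Path a₀ a₀ :=
      { toFun := fun s => eA.symm ⟨δ s, hδ s⟩
        continuous_toFun := eA.symm.continuous.comp (δ.continuous.subtype_mk _)
        source' := by
          have h0 : (⟨δ 0, hδ 0⟩ : range jA) = ⟨x₀, hx₀U⟩ := Subtype.ext δ.source
          simp only [h0, hends]
        target' := by
          have h1 : (⟨δ 1, hδ 1⟩ : range jA) = ⟨x₀, hx₀U⟩ := Subtype.ext δ.target
          simp only [h1, hends] }
    have hδ' : δ'.map hjA = δ := by
      ext s
      exact hlift s
    have h1 : φ (FundamentalGroup.fromPath (Path.Homotopic.Quotient.mk δ')) = 1 := by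
      rw [← MonoidHom.mem_ker, hker]
      exact Subgroup.mem_top _
    rw [hφ, FundamentalGroup.one_def, ← Path.Homotopic.Quotient.mk_refl, hδ'] at h1
    exact Path.Homotopic.Quotient.eq.mp h1
  -- path-connectedness of the pieces
  haveI : PathConnectedSpace K.complement := ν.pathConnectedSpace_complement
  have hUpc : IsPathConnected (range jA) := isPathConnected_range hjA
  have hVpc : IsPathConnected (range jB) := isPathConnected_range hjB
  exact simplyConnectedSpace_of_isOpen_cover_of_loops hAo hBo hU hx₀U hx₀V hUpc hVpc hloopU
    hloopV hmeet

/-- The `𝓡 4`-modelled, universe-polymorphic specialisation of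
`simplyConnectedSpace_of_isGluckTwist_of`, in the exact shape of the hypothesis `hπ` of
`nonempty_homotopyEquiv_sphere_of_isGluckTwist_of` (`GluckTwistHomotopySphere.lean`).
[cite: GluckTAMS1962, §17] -/
theorem simplyConnectedSpace_of_isGluckTwist_of_euclidean
    (hK : TwoKnot.normalClosure_meridian_eq_top) :
    ∀ {X : Type*} [TopologicalSpace X] [ChartedSpace (𝔼 4) X],
      simplyConnectedSpace_of_isGluckTwist (IX := 𝓡 4) (X := X) (K := K) :=
  fun {_} _ _ => simplyConnectedSpace_of_isGluckTwist_of hK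

omit K in
/-- **The route fact `gluck_simplyConnected` (`GluckTwistFacts.lean`) from Kervaire's lemma**:
every Gluck twist (universe `0`, Hausdorff, second countable, smooth) is simply connected.
[cite: GluckTAMS1962, §17] -/
theorem gluck_simplyConnected_of (hK : TwoKnot.normalClosure_meridian_eq_top) :
    gluck_simplyConnected :=
  fun _ _ _ _ _ _ _ h => simplyConnectedSpace_of_isGluckTwist_of hK h

end GluckTwist

end Literature.Topology.FourManifolds

end
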